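import Mathlib
import HarnessLib
import Literature.Analysis.FluidPDE.ParasiticSlabFlow
import Summits.NavierStokesRegularity.NavierStokesRegularity.Theorems.PoloidalWindowRigidity.Negative.CellField

/-!
# Item `LrcModEntire` (stmt-NavierStokesRegularity-20428, route `PoloidalWindowDoor`; = the registered stub
# `stub_lrcModEntire` of crux K2 `PoloidalWindowRigidity`, skeleton lrc-jet v3) — negative side:
# the SHIFTED cellular poloidal Type-I profile (kinematics)

Negative-side support (refuter seat ns-regularity-refuter1, cell ns-regularity-ideate; D-0081 §C). This file builds the
witness used in `…Theorems.LrcModEntire.Negative.FalseWithoutMild` to show that the item `LrcModEntire` is FALSE once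
the Oseen-mild identity (M) is deleted. All earlier (M)-free witnesses of this lane (the cellular, drifting, three-wave
and three-sheet profiles of `…Theorems.PoloidalWindowRigidity.Negative.*`) have the CONSTANT shear slope
`∂₂vₕ = −∇ₕv₂` and are therefore excluded by the slope clause (`∇Λ ≠ 0`) of the item; the present witness has a
spatially varying slope:

* `shiftField`: `V(x) = (cos x₂ cos x₀, cos x₂ cos x₁, (sin x₂ + 3)(sin x₀ + sin x₁))` — the member `A = cos x₂`,
  `B = sin x₂ + 3`, `P = sin x₀ + sin x₁` of the kinematic family `(A ∂₀P, A ∂₁P, B P)`, `ΔₕP = −P`, `B′ = A` of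
  `…Negative.CellField` (`V = cellField + 3 (sin x₀ + sin x₁) e₂`); its derivative as an explicit continuous linear
  map (`hasFDerivAt_shiftField`), `‖V‖ ≤ 10`;
* `vortField`, `vortDeriv`: the vorticity pattern `K = curl V = (2 sin x₂ + 3)(cos x₁, −cos x₀, 0)` and its
  derivative;
* `shiftProfile`: the Type-I profile `v(t, x) = (−t)^{-1/2} V(x)`, with `curl v(t) = (−t)^{-1/2} K`
  (`curl_shiftProfile`), the directional derivatives `∂₂ vₕ`, `∇ₕ v₂` and `D(curl v(t))` in closed form, and
  PROPORTIONAL SHEAR of NON-CONSTANT slope `(sin x₂ + 3) ∂₂ vₕ = −sin x₂ ∇ₕ v₂` (`proportionalShear_shiftProfile`),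
  i.e. `μ(x₂) = −sin x₂ / (sin x₂ + 3)`;
* the class data: (R) Type-I rate `10` (`hasTypeITimeDecay_shiftProfile`), (C) joint continuity on the open backward
  slab, (D) divergence-free slices, (P) poloidal along `e₂`, (F) the frozen constraint.

WHAT THIS IS NOT: not a claim about Navier–Stokes regularity — explicit vector calculus for a kinematic witness.
-/

noncomputable section

-- the summit and its single sub-problem share the name (CONVENTIONS §1), as in every Theorems file
set_option linter.dupNamespace false

namespace Summit.NavierStokesRegularity.NavierStokesRegularity.Theorems.LrcModEntire.Negative

open MeasureTheory Set Function Filter Topology Metric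
open scoped RealInnerProductSpace InnerProductSpace
open Literature.Analysis Literature.Analysis.FluidPDE
open Summit.NavierStokesRegularity.NavierStokesRegularity.Theorems.PoloidalWindowRigidity.Negative

local notation "E3" => EuclideanSpace ℝ (Fin 3)
local notation "π" i => (EuclideanSpace.proj (𝕜 := ℝ) (i : Fin 3) : EuclideanSpace ℝ (Fin 3) →L[ℝ] ℝ)
local notation "𝐞" i => (EuclideanSpace.single (i : Fin 3) (1 : ℝ) : EuclideanSpace ℝ (Fin 3))

/-! ## The shifted cellular field -/

/-- The shifted cellular field `V(x) = (cos x₂ cos x₀, cos x₂ cos x₁, (sin x₂ + 3)(sin x₀ + sin x₁))`. [folklore] -/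
def shiftField (x : E3) : E3 :=
  (Real.cos (x 2) * Real.cos (x 0)) • (𝐞 0) + (Real.cos (x 2) * Real.cos (x 1)) • (𝐞 1) +
    ((Real.sin (x 2) + 3) * (Real.sin (x 0) + Real.sin (x 1))) • (𝐞 2)

/-- The derivative `DV(x)` of the shifted cellular field, as an explicit continuous linear map. [folklore] -/
def shiftDeriv (x : E3) : E3 →L[ℝ] E3 :=
  (Real.cos (x 2) • (-(Real.sin (x 0)) • (π 0)) + Real.cos (x 0) • (-(Real.sin (x 2)) • (π 2))).smulRight (𝐞 0) +
  (Real.cos (x 2) • (-(Real.sin (x 1)) • (π 1)) + Real.cos (x 1) • (-(Real.sin (x 2)) • (π 2))).smulRight (𝐞 1) +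
  ((Real.sin (x 2) + 3) • (Real.cos (x 0) • (π 0) + Real.cos (x 1) • (π 1)) +
      (Real.sin (x 0) + Real.sin (x 1)) • (Real.cos (x 2) • (π 2))).smulRight (𝐞 2)

/-- `V` is differentiable with derivative `shiftDeriv`. [folklore] -/
theorem hasFDerivAt_shiftField (x : E3) : HasFDerivAt shiftField (shiftDeriv x) x := by
  have h0 : HasFDerivAt (fun y : E3 => y 0) (π 0) x := (π 0).hasFDerivAt
  have h1 : HasFDerivAt (fun y : E3 => y 1) (π 1) x := (π 1).hasFDerivAt
  have h2 : HasFDerivAt (fun y : E3 => y 2) (π 2) x := (π 2).hasFDerivAt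
  have hc0 := (Real.hasDerivAt_cos (x 0)).comp_hasFDerivAt x h0
  have hc1 := (Real.hasDerivAt_cos (x 1)).comp_hasFDerivAt x h1
  have hc2 := (Real.hasDerivAt_cos (x 2)).comp_hasFDerivAt x h2
  have hs0 := (Real.hasDerivAt_sin (x 0)).comp_hasFDerivAt x h0
  have hs1 := (Real.hasDerivAt_sin (x 1)).comp_hasFDerivAt x h1
  have hs2 := (Real.hasDerivAt_sin (x 2)).comp_hasFDerivAt x h2
  have H := (((hc2.mul hc0).smul_const (𝐞 0)).add ((hc2.mul hc1).smul_const (𝐞 1))).add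
    (((hs2.add_const 3).mul (hs0.add hs1)).smul_const (𝐞 2))
  exact H

/-- `DV = shiftDeriv`. [folklore] -/
theorem fderiv_shiftField (x : E3) : fderiv ℝ shiftField x = shiftDeriv x :=
  (hasFDerivAt_shiftField x).fderiv

/-- `V` is continuous. [folklore] -/
theorem continuous_shiftField : Continuous shiftField := by
  have hd : Differentiable ℝ shiftField := fun x => (hasFDerivAt_shiftField x).differentiableAt
  exact hd.continuous

/-- `DV(x) w` in coordinates. [folklore] -/
theorem shiftDeriv_apply (x w : E3) : shiftDeriv x w =
    (Real.cos (x 2) * (-(Real.sin (x 0)) * w 0) + Real.cos (x 0) * (-(Real.sin (x 2)) * w 2)) • (𝐞 0) +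
    (Real.cos (x 2) * (-(Real.sin (x 1)) * w 1) + Real.cos (x 1) * (-(Real.sin (x 2)) * w 2)) • (𝐞 1) +
    ((Real.sin (x 2) + 3) * (Real.cos (x 0) * w 0 + Real.cos (x 1) * w 1) +
      (Real.sin (x 0) + Real.sin (x 1)) * (Real.cos (x 2) * w 2)) • (𝐞 2) := by
  rfl

/-- The components of `V(x)`. [folklore] -/
theorem shiftField_apply_zero (x : E3) : shiftField x 0 = Real.cos (x 2) * Real.cos (x 0) := by
  simp [shiftField]

/-- The second component of `V(x)`. [folklore] -/
theorem shiftField_apply_one (x : E3) : shiftField x 1 = Real.cos (x 2) * Real.cos (x 1) := by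
  simp [shiftField]

/-- The third component of `V(x)`. [folklore] -/
theorem shiftField_apply_two (x : E3) :
    shiftField x 2 = (Real.sin (x 2) + 3) * (Real.sin (x 0) + Real.sin (x 1)) := by
  simp [shiftField]

/-- The components of `DV(x) w`. [folklore] -/
theorem shiftDeriv_apply_zero (x w : E3) : shiftDeriv x w 0 =
    Real.cos (x 2) * (-(Real.sin (x 0)) * w 0) + Real.cos (x 0) * (-(Real.sin (x 2)) * w 2) := by
  rw [shiftDeriv_apply]; simp

/-- The second component of `DV(x) w`. [folklore] -/
theorem shiftDeriv_apply_one (x w : E3) : shiftDeriv x w 1 =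
    Real.cos (x 2) * (-(Real.sin (x 1)) * w 1) + Real.cos (x 1) * (-(Real.sin (x 2)) * w 2) := by
  rw [shiftDeriv_apply]; simp

/-- The third component of `DV(x) w`. [folklore] -/
theorem shiftDeriv_apply_two (x w : E3) : shiftDeriv x w 2 =
    (Real.sin (x 2) + 3) * (Real.cos (x 0) * w 0 + Real.cos (x 1) * w 1) +
      (Real.sin (x 0) + Real.sin (x 1)) * (Real.cos (x 2) * w 2) := by
  rw [shiftDeriv_apply]; simp

/-- `‖V(x)‖ ≤ 10`. [folklore] -/
theorem norm_shiftField_le (x : E3) : ‖shiftField x‖ ≤ 10 := by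
  have hc0 := Real.abs_cos_le_one (x 0)
  have hc1 := Real.abs_cos_le_one (x 1)
  have hc2 := Real.abs_cos_le_one (x 2)
  have hs0 := Real.abs_sin_le_one (x 0)
  have hs1 := Real.abs_sin_le_one (x 1)
  have e0 : ‖(𝐞 0)‖ = 1 := by simp
  have e1 : ‖(𝐞 1)‖ = 1 := by simp
  have e2 : ‖(𝐞 2)‖ = 1 := by simp
  unfold shiftField
  refine (norm_add_le _ _).trans ?_
  refine (add_le_add (norm_add_le _ _) le_rfl).trans ?_
  rw [norm_smul, norm_smul, norm_smul, e0, e1, e2, mul_one, mul_one, mul_one, Real.norm_eq_abs,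
    Real.norm_eq_abs, Real.norm_eq_abs, abs_mul, abs_mul, abs_mul]
  have h1 : |Real.cos (x 2)| * |Real.cos (x 0)| ≤ 1 := by
    nlinarith [abs_nonneg (Real.cos (x 2)), abs_nonneg (Real.cos (x 0))]
  have h2 : |Real.cos (x 2)| * |Real.cos (x 1)| ≤ 1 := by
    nlinarith [abs_nonneg (Real.cos (x 2)), abs_nonneg (Real.cos (x 1))]
  have h4 : |Real.sin (x 2) + 3| ≤ 4 := by
    rw [abs_le]
    constructor <;> linarith [Real.neg_one_le_sin (x 2), Real.sin_le_one (x 2)]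
  have h5 : |Real.sin (x 0) + Real.sin (x 1)| ≤ 2 := (abs_add_le _ _).trans (by linarith)
  have h3 : |Real.sin (x 2) + 3| * |Real.sin (x 0) + Real.sin (x 1)| ≤ 4 * 2 :=
    mul_le_mul h4 h5 (abs_nonneg _) (by norm_num)
  linarith

/-! ## The vorticity pattern and its derivative -/

/-- The vorticity pattern `K(x) = ((2 sin x₂ + 3) cos x₁, −(2 sin x₂ + 3) cos x₀, 0)` (`curl V = K`). [folklore] -/
def vortField (x : E3) : E3 :=
  ((2 * Real.sin (x 2) + 3) * Real.cos (x 1)) • (𝐞 0) + (-((2 * Real.sin (x 2) + 3) * Real.cos (x 0))) • (𝐞 1)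

/-- The derivative `DK(x)` of the vorticity pattern, as an explicit continuous linear map. [folklore] -/
def vortDeriv (x : E3) : E3 →L[ℝ] E3 :=
  ((2 * Real.sin (x 2) + 3) • (-(Real.sin (x 1)) • (π 1)) +
      Real.cos (x 1) • ((2 : ℝ) • (Real.cos (x 2) • (π 2)))).smulRight (𝐞 0) +
  (-((2 * Real.sin (x 2) + 3) • (-(Real.sin (x 0)) • (π 0)) +
      Real.cos (x 0) • ((2 : ℝ) • (Real.cos (x 2) • (π 2))))).smulRight (𝐞 1)

/-- `K` is differentiable with derivative `vortDeriv`. [folklore] -/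
theorem hasFDerivAt_vortField (x : E3) : HasFDerivAt vortField (vortDeriv x) x := by
  have h0 : HasFDerivAt (fun y : E3 => y 0) (π 0) x := (π 0).hasFDerivAt
  have h1 : HasFDerivAt (fun y : E3 => y 1) (π 1) x := (π 1).hasFDerivAt
  have h2 : HasFDerivAt (fun y : E3 => y 2) (π 2) x := (π 2).hasFDerivAt
  have hc0 := (Real.hasDerivAt_cos (x 0)).comp_hasFDerivAt x h0
  have hc1 := (Real.hasDerivAt_cos (x 1)).comp_hasFDerivAt x h1
  have hs2 := (Real.hasDerivAt_sin (x 2)).comp_hasFDerivAt x h2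
  have h2s : HasFDerivAt (fun y : E3 => 2 * Real.sin (y 2) + 3) ((2 : ℝ) • (Real.cos (x 2) • (π 2))) x :=
    (hs2.const_mul 2).add_const 3
  have H := ((h2s.mul hc1).smul_const (𝐞 0)).add (((h2s.mul hc0).neg).smul_const (𝐞 1))
  exact H

/-- `DK(x) w` in coordinates. [folklore] -/
theorem vortDeriv_apply (x w : E3) : vortDeriv x w =
    ((2 * Real.sin (x 2) + 3) * (-(Real.sin (x 1)) * w 1) + Real.cos (x 1) * (2 * (Real.cos (x 2) * w 2))) • (𝐞 0) +
    (-((2 * Real.sin (x 2) + 3) * (-(Real.sin (x 0)) * w 0) + Real.cos (x 0) * (2 * (Real.cos (x 2) * w 2)))) •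
      (𝐞 1) := by
  rfl

/-- The components of `DK(x) w`. [folklore] -/
theorem vortDeriv_apply_zero (x w : E3) : vortDeriv x w 0 =
    (2 * Real.sin (x 2) + 3) * (-(Real.sin (x 1)) * w 1) + Real.cos (x 1) * (2 * (Real.cos (x 2) * w 2)) := by
  rw [vortDeriv_apply]; simp

/-- The second component of `DK(x) w`. [folklore] -/
theorem vortDeriv_apply_one (x w : E3) : vortDeriv x w 1 =
    -((2 * Real.sin (x 2) + 3) * (-(Real.sin (x 0)) * w 0) + Real.cos (x 0) * (2 * (Real.cos (x 2) * w 2))) := by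
  rw [vortDeriv_apply]; simp

/-- The third component of `DK(x) w` vanishes. [folklore] -/
theorem vortDeriv_apply_two (x w : E3) : vortDeriv x w 2 = 0 := by
  rw [vortDeriv_apply]; simp

/-! ## The shifted cellular Type-I profile `v(t, x) = (−t)^{-1/2} V(x)` -/

/-- The shifted cellular profile `v(t, x) = (−t)^{-1/2} V(x)` (`cellAmp t = (−t)^{-1/2}` of `…Negative.CellField`).
[folklore] -/
def shiftProfile (t : ℝ) (x : E3) : E3 := cellAmp t • shiftField x

/-- `Dv(t) = (−t)^{-1/2} DV`. [folklore] -/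
theorem fderiv_shiftProfile (t : ℝ) (x : E3) : fderiv ℝ (shiftProfile t) x = cellAmp t • shiftDeriv x :=
  ((hasFDerivAt_shiftField x).const_smul (cellAmp t)).fderiv

/-- `Dv(t)(x) w` in coordinates: `(−t)^{-1/2} (DV(x) w)ᵢ`. [folklore] -/
theorem fderiv_shiftProfile_apply (t : ℝ) (x w : E3) (i : Fin 3) :
    fderiv ℝ (shiftProfile t) x w i = cellAmp t * shiftDeriv x w i := by
  rw [fderiv_shiftProfile]; rfl

/-- `∂₂ v₀ = −(−t)^{-1/2} sin x₂ cos x₀`. [folklore] -/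
theorem fderiv_shiftProfile_e2_apply_zero (t : ℝ) (x : E3) :
    fderiv ℝ (shiftProfile t) x (𝐞 2) 0 = cellAmp t * (-(Real.sin (x 2)) * Real.cos (x 0)) := by
  rw [fderiv_shiftProfile_apply, shiftDeriv_apply_zero, show (𝐞 2) 0 = 0 by simp, show (𝐞 2) 2 = 1 by simp]
  ring

/-- `∂₂ v₁ = −(−t)^{-1/2} sin x₂ cos x₁`. [folklore] -/
theorem fderiv_shiftProfile_e2_apply_one (t : ℝ) (x : E3) :
    fderiv ℝ (shiftProfile t) x (𝐞 2) 1 = cellAmp t * (-(Real.sin (x 2)) * Real.cos (x 1)) := by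
  rw [fderiv_shiftProfile_apply, shiftDeriv_apply_one, show (𝐞 2) 1 = 0 by simp, show (𝐞 2) 2 = 1 by simp]
  ring

/-- `∂₀ v₂ = (−t)^{-1/2} (sin x₂ + 3) cos x₀`. [folklore] -/
theorem fderiv_shiftProfile_e0_apply_two (t : ℝ) (x : E3) :
    fderiv ℝ (shiftProfile t) x (𝐞 0) 2 = cellAmp t * ((Real.sin (x 2) + 3) * Real.cos (x 0)) := by
  rw [fderiv_shiftProfile_apply, shiftDeriv_apply_two, show (𝐞 0) 0 = 1 by simp, show (𝐞 0) 1 = 0 by simp,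
    show (𝐞 0) 2 = 0 by simp]
  ring

/-- `∂₁ v₂ = (−t)^{-1/2} (sin x₂ + 3) cos x₁`. [folklore] -/
theorem fderiv_shiftProfile_e1_apply_two (t : ℝ) (x : E3) :
    fderiv ℝ (shiftProfile t) x (𝐞 1) 2 = cellAmp t * ((Real.sin (x 2) + 3) * Real.cos (x 1)) := by
  rw [fderiv_shiftProfile_apply, shiftDeriv_apply_two, show (𝐞 1) 0 = 0 by simp, show (𝐞 1) 1 = 1 by simp,
    show (𝐞 1) 2 = 0 by simp]
  ring

/-- **Proportional shear with non-constant slope**: `(sin x₂ + 3) ∂₂ v_b = −sin x₂ ∂_b v₂` for `b = 0, 1`, i.e. the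
shear slope of the witness is `μ(x₂) = −sin x₂ / (sin x₂ + 3)` — a non-constant function of `x₂` alone (the earlier
witnesses of this lane all have `μ ≡ −1`). [folklore] -/
theorem proportionalShear_shiftProfile (t : ℝ) (x : E3) :
    (Real.sin (x 2) + 3) * fderiv ℝ (shiftProfile t) x (𝐞 2) 0 =
        -(Real.sin (x 2)) * fderiv ℝ (shiftProfile t) x (𝐞 0) 2 ∧
      (Real.sin (x 2) + 3) * fderiv ℝ (shiftProfile t) x (𝐞 2) 1 =
        -(Real.sin (x 2)) * fderiv ℝ (shiftProfile t) x (𝐞 1) 2 := by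
  rw [fderiv_shiftProfile_e2_apply_zero, fderiv_shiftProfile_e0_apply_two, fderiv_shiftProfile_e2_apply_one,
    fderiv_shiftProfile_e1_apply_two]
  constructor <;> ring

/-- **The vorticity of the shifted cellular profile**: `curl v(t) = (−t)^{-1/2} K`, i.e.
`curl v(t)(x) = (−t)^{-1/2} (2 sin x₂ + 3)(cos x₁, −cos x₀, 0)` — horizontal (poloidal along `e₂`). [folklore] -/
theorem curl_shiftProfile (t : ℝ) (x : E3) : curl (shiftProfile t) x = cellAmp t • vortField x := by
  ext i
  fin_cases i <;>
    simp [curl, vortField, fderiv_shiftProfile, shiftDeriv_apply_zero, shiftDeriv_apply_one,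
      shiftDeriv_apply_two] <;> ring

/-- The vorticity slice as a function. [folklore] -/
theorem curl_shiftProfile_eq (t : ℝ) : curl (shiftProfile t) = fun x => cellAmp t • vortField x :=
  funext (curl_shiftProfile t)

/-- The components of `curl v(t)(x)`. [folklore] -/
theorem curl_shiftProfile_apply_zero (t : ℝ) (x : E3) :
    curl (shiftProfile t) x 0 = cellAmp t * ((2 * Real.sin (x 2) + 3) * Real.cos (x 1)) := by
  rw [curl_shiftProfile]; simp [vortField]

/-- The second component of `curl v(t)(x)`. [folklore] -/
theorem curl_shiftProfile_apply_one (t : ℝ) (x : E3) :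
    curl (shiftProfile t) x 1 = -(cellAmp t * ((2 * Real.sin (x 2) + 3) * Real.cos (x 0))) := by
  rw [curl_shiftProfile]; simp [vortField]

/-- The third component of `curl v(t)(x)` vanishes (poloidal along `e₂`). [folklore] -/
theorem curl_shiftProfile_apply_two (t : ℝ) (x : E3) : curl (shiftProfile t) x 2 = 0 := by
  rw [curl_shiftProfile]; simp [vortField]

/-- `D(curl v(t)) = (−t)^{-1/2} DK`. [folklore] -/
theorem hasFDerivAt_curl_shiftProfile (t : ℝ) (x : E3) :
    HasFDerivAt (curl (shiftProfile t)) (cellAmp t • vortDeriv x) x := by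
  rw [curl_shiftProfile_eq]
  exact (hasFDerivAt_vortField x).const_smul (cellAmp t)

/-- `D(curl v(t))(x) w` in coordinates. [folklore] -/
theorem fderiv_curl_shiftProfile_apply (t : ℝ) (x w : E3) (i : Fin 3) :
    fderiv ℝ (curl (shiftProfile t)) x w i = cellAmp t * vortDeriv x w i := by
  rw [(hasFDerivAt_curl_shiftProfile t x).fderiv]; rfl

/-- The first component of `D(curl v(t))(x) w`. [folklore] -/
theorem fderiv_curl_shiftProfile_apply_zero (t : ℝ) (x w : E3) :
    fderiv ℝ (curl (shiftProfile t)) x w 0 =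
      cellAmp t * (-(2 * Real.sin (x 2) + 3) * Real.sin (x 1) * w 1 + 2 * Real.cos (x 1) * Real.cos (x 2) * w 2) := by
  rw [fderiv_curl_shiftProfile_apply, vortDeriv_apply_zero]; ring

/-- The second component of `D(curl v(t))(x) w`. [folklore] -/
theorem fderiv_curl_shiftProfile_apply_one (t : ℝ) (x w : E3) :
    fderiv ℝ (curl (shiftProfile t)) x w 1 =
      cellAmp t * ((2 * Real.sin (x 2) + 3) * Real.sin (x 0) * w 0 - 2 * Real.cos (x 0) * Real.cos (x 2) * w 2) := by
  rw [fderiv_curl_shiftProfile_apply, vortDeriv_apply_one]; ring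

/-! ## The class hypotheses (R), (C), (D), (P) and the frozen constraint -/

/-- `‖v(t)(x)‖ ≤ 10 (−t)^{-1/2}`. [folklore] -/
theorem norm_shiftProfile_le (t : ℝ) (x : E3) : ‖shiftProfile t x‖ ≤ cellAmp t * 10 := by
  unfold shiftProfile
  rw [norm_smul, Real.norm_of_nonneg (cellAmp_nonneg t)]
  exact mul_le_mul_of_nonneg_left (norm_shiftField_le x) (cellAmp_nonneg t)

/-- (R) the Type-I time rate with constant `10`. [folklore] -/
theorem hasTypeITimeDecay_shiftProfile : HasTypeITimeDecay 10 shiftProfile := by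
  intro t _ x
  have h := norm_shiftProfile_le t x
  rw [cellAmp] at h
  rw [div_eq_inv_mul]
  exact h

/-- (C) continuity on the open backward slab. [folklore] -/
theorem continuousOn_shiftProfile :
    ContinuousOn (Function.uncurry shiftProfile) (Set.Iio (0 : ℝ) ×ˢ Set.univ) := by
  have hamp : ContinuousOn (fun z : ℝ × E3 => cellAmp z.1) (Set.Iio (0 : ℝ) ×ˢ Set.univ) := by
    refine ContinuousOn.inv₀ ?_ fun z hz => (Real.sqrt_pos.2 (neg_pos.2 (show z.1 < 0 from hz.1))).ne'
    exact ((Real.continuous_sqrt.comp continuous_neg).comp continuous_fst).continuousOn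
  exact hamp.smul (continuous_shiftField.comp continuous_snd).continuousOn

/-- (D) divergence-free slices: `div V = −cos x₂ sin x₀ − cos x₂ sin x₁ + (sin x₀ + sin x₁) cos x₂ = 0`. [folklore] -/
theorem isDivFree_shiftProfile (t : ℝ) : VectorCalculus.IsDivFree (shiftProfile t) := by
  intro y
  rw [divergence_eq_sum_inner_fderiv (EuclideanSpace.basisFun (Fin 3) ℝ), Fin.sum_univ_three]
  simp only [EuclideanSpace.basisFun_apply, EuclideanSpace.inner_single_left, map_one, one_mul,
    fderiv_shiftProfile_apply,
    shiftDeriv_apply_zero, shiftDeriv_apply_one, shiftDeriv_apply_two, PiLp.single_apply]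
  simp
  ring

/-- (P) poloidal along `e₂` everywhere on every slice. [folklore] -/
theorem poloidal_shiftProfile (s : ℝ) (y : E3) : ⟪curl (shiftProfile s) y, (𝐞 2)⟫_ℝ = 0 := by
  rw [EuclideanSpace.inner_single_right, curl_shiftProfile_apply_two]
  simp

/-- (F) the frozen constraint `⟪Dv(s)(y) curl v(s)(y), e₂⟫ = 0` (`v·e₂` is a first integral of the vortex lines;
not a hypothesis of the item, recorded to show that the witness also has it). [folklore] -/
theorem frozen_shiftProfile (s : ℝ) (y : E3) :
    ⟪fderiv ℝ (shiftProfile s) y (curl (shiftProfile s) y), (𝐞 2)⟫_ℝ = 0 := by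
  rw [EuclideanSpace.inner_single_right, fderiv_shiftProfile_apply, shiftDeriv_apply_two,
    curl_shiftProfile_apply_zero, curl_shiftProfile_apply_one, curl_shiftProfile_apply_two, RCLike.conj_to_real]
  ring

end Summit.NavierStokesRegularity.NavierStokesRegularity.Theorems.LrcModEntire.Negative

end
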